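import Summits.QuantumFields.YangMills.Theorems.ColdStartUniversalityLatticeLangevinMeasurableFlow
import Summits.QuantumFields.YangMills.Theorems.ColdStartUniversalityLatticeLangevinLawUniqueStart
import HarnessLib

/-!
# Route `ColdStartUniversality` (rung input (M) groundwork, crux K_A1 stmt-QuantumFields-24809): the FELLER PROPERTY
# of the SU(2) lattice Langevin dynamics

Helper file (seat `ym-line-csu-p1`, g4).  For every continuous observable `f` on `SU(2)^E` and every lattice time `t`,
the transition operator `x ↦ P_t f(x) = E f(U^x_t)` is continuous — for any Markov kernel family realising the
transition laws of the Shen–Zhu–Zhu dynamics (`continuous_integral_transitionKernel`), and in the raw form «solutions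
from converging starts, same flat driver, have converging expectations» (`tendsto_integral_solutions`).

Proof: `f` is uniformly continuous for the squared Hilbert–Schmidt «distance» (compactness of `SU(2)^E`,
`exists_hsDist_modulus`); the quantitative continuous dependence `latticeLangevin_contDep` (seat g3) and Markov's
inequality make `P(D(U^{x_n}_t, U^x_t) ≥ δ) → 0`; split `E|f(U^{x_n}_t) − f(U^x_t)|` on that event.

This is the Feller ingredient of the Markov-semigroup route to the rung's open inputs: Krylov–Bogoliubov
(`Literature.Probability.Process.KrylovBogoliubov`), small sets (`…SmallSets`), and step (iv) of the Chapman–Kolmogorov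
proof planned in the seat notes.  No definition, no sorry.  RECORD-rung R3 plumbing; nothing here bears on the mass gap.
-/

set_option autoImplicit false

noncomputable section

namespace Summit.QuantumFields.YangMills.Theorems.ColdStartUniversality

open MeasureTheory ProbabilityTheory Filter Topology
open scoped NNReal ENNReal BigOperators
open Literature.Probability.Process Literature.MathematicalPhysics.QuantumFieldTheory
open Literature.MathematicalPhysics.QuantumLattice (fundamentalRep fundamentalLatticeRep continuous_fundamentalRep
  fundamentalRep_injective)

variable {L : ℕ} [NeZero L]

/-- The «distance» separates points: `Σ_e ‖ρ(a e) − ρ(b e)‖_F² = 0 → a = b` (faithfulness of the fundamental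
representation). [folklore] -/
theorem eq_of_hsDist_eq_zero {a b : GaugeConfig 3 L (Matrix.specialUnitaryGroup (Fin 2) ℂ)}
    (h : ∑ e, hsForm 2 ((fundamentalRep (Fin 2) (a e) : Matrix (Fin 2) (Fin 2) ℂ) - fundamentalRep (Fin 2) (b e))
        ((fundamentalRep (Fin 2) (a e) : Matrix (Fin 2) (Fin 2) ℂ) - fundamentalRep (Fin 2) (b e)) = 0) :
    a = b := by
  funext e
  have he := (Finset.sum_eq_zero_iff_of_nonneg (fun e _ => hsForm_self_nonneg _)).1 h e (Finset.mem_univ e)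
  have hsub : (fundamentalRep (Fin 2) (a e) : Matrix (Fin 2) (Fin 2) ℂ) - fundamentalRep (Fin 2) (b e) = 0 :=
    hsForm_self_eq_zero.1 he
  exact fundamentalRep_injective (Fin 2) (sub_eq_zero.1 hsub)

/-- **Uniform continuity of a continuous observable for the «distance»** (compactness of `SU(2)^E`): for every
`ε > 0` there is `δ > 0` with `|f a − f b| < ε` whenever `Σ_e ‖ρ(a e) − ρ(b e)‖_F² < δ`. [folklore] -/
theorem exists_hsDist_modulus {f : GaugeConfig 3 L (Matrix.specialUnitaryGroup (Fin 2) ℂ) → ℝ} (hf : Continuous f)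
    {ε : ℝ} (hε : 0 < ε) :
    ∃ δ : ℝ, 0 < δ ∧ ∀ a b : GaugeConfig 3 L (Matrix.specialUnitaryGroup (Fin 2) ℂ),
      ∑ e, hsForm 2 ((fundamentalRep (Fin 2) (a e) : Matrix (Fin 2) (Fin 2) ℂ) - fundamentalRep (Fin 2) (b e))
          ((fundamentalRep (Fin 2) (a e) : Matrix (Fin 2) (Fin 2) ℂ) - fundamentalRep (Fin 2) (b e)) < δ →
        |f a - f b| < ε := by
  set K : Set (GaugeConfig 3 L (Matrix.specialUnitaryGroup (Fin 2) ℂ) ×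
      GaugeConfig 3 L (Matrix.specialUnitaryGroup (Fin 2) ℂ)) := {p | ε ≤ |f p.1 - f p.2|} with hK
  have hKc : IsClosed K := isClosed_le continuous_const ((hf.comp continuous_fst).sub (hf.comp continuous_snd)).abs
  have hKcpt : IsCompact K := hKc.isCompact
  have hDc := continuous_hsDist (L := L) (X := GaugeConfig 3 L (Matrix.specialUnitaryGroup (Fin 2) ℂ) ×
      GaugeConfig 3 L (Matrix.specialUnitaryGroup (Fin 2) ℂ)) continuous_fst continuous_snd
  by_cases hKne : K.Nonempty
  · obtain ⟨p₀, hp₀K, hmin⟩ := hKcpt.exists_isMinOn hKne hDc.continuousOn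
    refine ⟨∑ e, hsForm 2 ((fundamentalRep (Fin 2) (p₀.1 e) : Matrix (Fin 2) (Fin 2) ℂ) - fundamentalRep (Fin 2) (p₀.2 e))
        ((fundamentalRep (Fin 2) (p₀.1 e) : Matrix (Fin 2) (Fin 2) ℂ) - fundamentalRep (Fin 2) (p₀.2 e)), ?_,
      fun a b hab => ?_⟩
    · -- the minimum is positive: `D p₀ = 0` would force `p₀.1 = p₀.2`, contradicting `ε ≤ |f p₀.1 - f p₀.2|`
      rcases (hsDist_nonneg p₀.1 p₀.2).lt_or_eq with hpos | hzero
      · exact hpos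
      · exfalso
        have heq := eq_of_hsDist_eq_zero hzero.symm
        have hp : ε ≤ |f p₀.1 - f p₀.2| := hp₀K
        rw [heq, sub_self, abs_zero] at hp
        exact absurd hp (not_le.2 hε)
    · by_contra hcon
      have hmem : (a, b) ∈ K := not_lt.1 hcon
      exact absurd (hmin hmem) (not_le.2 hab)
  · refine ⟨1, one_pos, fun a b _ => ?_⟩
    by_contra hcon
    exact hKne ⟨(a, b), not_lt.1 hcon⟩

omit [NeZero L] in
/-- A continuous real observable on the compact `SU(2)^E` is bounded. [folklore] -/
theorem exists_abs_le_of_continuous {f : GaugeConfig 3 L (Matrix.specialUnitaryGroup (Fin 2) ℂ) → ℝ}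
    (hf : Continuous f) : ∃ M : ℝ, 0 ≤ M ∧ ∀ x, |f x| ≤ M := by
  obtain ⟨x₀, -, hx₀⟩ := isCompact_univ.exists_isMaxOn Set.univ_nonempty hf.abs.continuousOn
  exact ⟨|f x₀|, abs_nonneg _, fun x => hx₀ (Set.mem_univ x)⟩

/-- **Expectations along solutions from converging starts converge** (same space, same flat driver): if
`xₙ → x` and `Uⁿ`, `U` solve the SU(2) SZZ system from `xₙ`, `x`, then `E f(Uⁿ_t) → E f(U_t)` for continuous `f`.
(Uniform continuity of `f` for the «distance», `latticeLangevin_contDep`, Markov's inequality.)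
[cite: RevuzYor1999, Ch. IX Thm (2.1)] -/
theorem tendsto_integral_solutions {Ω : Type*} {mΩ : MeasurableSpace Ω} {P : Measure Ω} [IsProbabilityMeasure P]
    {W : ℝ≥0 → Ω → (Edge 3 L × NoiseIdx 2 → ℝ)} (hW : IsFlatBrownian W P) (β : ℝ)
    {xs : ℕ → GaugeConfig 3 L (Matrix.specialUnitaryGroup (Fin 2) ℂ)}
    {x : GaugeConfig 3 L (Matrix.specialUnitaryGroup (Fin 2) ℂ)} (hxs : Tendsto xs atTop (𝓝 x))
    {V : ℕ → ℝ≥0 → Ω → GaugeConfig 3 L (Matrix.specialUnitaryGroup (Fin 2) ℂ)}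
    {U : ℝ≥0 → Ω → GaugeConfig 3 L (Matrix.specialUnitaryGroup (Fin 2) ℂ)}
    (hV0 : ∀ n ω, V n 0 ω = xs n)
    (hV : ∀ n, (latticeLangevinDynamics (fundamentalLatticeRep 2) β).IsSolution (fundamentalRep (Fin 2))
      hW.natFiltration P W (V n))
    (hU0 : ∀ ω, U 0 ω = x)
    (hU : (latticeLangevinDynamics (fundamentalLatticeRep 2) β).IsSolution (fundamentalRep (Fin 2))
      hW.natFiltration P W U)
    {f : GaugeConfig 3 L (Matrix.specialUnitaryGroup (Fin 2) ℂ) → ℝ} (hf : Continuous f) (t : ℝ≥0) :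
    Tendsto (fun n => ∫ ω, f (V n t ω) ∂P) atTop (𝓝 (∫ ω, f (U t ω) ∂P)) := by
  haveI := secondCountableTopology_su2
  haveI := borelSpace_config L
  obtain ⟨M, hM0, hM⟩ := exists_abs_le_of_continuous hf
  obtain ⟨C, hC⟩ := latticeLangevin_contDep L β t
  -- measurability
  have hVm : ∀ n, Measurable (V n t) := fun n => ((hV n).adapted t).mono (hW.natFiltration.le t) le_rfl
  have hUm : Measurable (U t) := (hU.adapted t).mono (hW.natFiltration.le t) le_rfl
  have hDm' : Measurable (fun p : GaugeConfig 3 L (Matrix.specialUnitaryGroup (Fin 2) ℂ) ×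
      GaugeConfig 3 L (Matrix.specialUnitaryGroup (Fin 2) ℂ) =>
      ∑ e, hsForm 2 ((fundamentalRep (Fin 2) (p.1 e) : Matrix (Fin 2) (Fin 2) ℂ) - fundamentalRep (Fin 2) (p.2 e))
        ((fundamentalRep (Fin 2) (p.1 e) : Matrix (Fin 2) (Fin 2) ℂ) - fundamentalRep (Fin 2) (p.2 e))) :=
    (continuous_hsDist continuous_fst continuous_snd).measurable
  have hDm : ∀ n, Measurable fun ω => ∑ e,
      hsForm 2 ((fundamentalRep (Fin 2) (V n t ω e) : Matrix (Fin 2) (Fin 2) ℂ) - fundamentalRep (Fin 2) (U t ω e))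
        ((fundamentalRep (Fin 2) (V n t ω e) : Matrix (Fin 2) (Fin 2) ℂ) - fundamentalRep (Fin 2) (U t ω e)) := by
    intro n
    have h := hDm'.comp ((hVm n).prodMk hUm)
    exact h
  have hfV : ∀ n, Measurable fun ω => f (V n t ω) := fun n => by
    have h := hf.measurable.comp (hVm n); exact h
  have hfU : Measurable fun ω => f (U t ω) := by
    have h := hf.measurable.comp hUm; exact h
  -- the start «distances» tend to zero
  have hD0 : Tendsto (fun n => ∑ e,
      hsForm 2 ((fundamentalRep (Fin 2) (xs n e) : Matrix (Fin 2) (Fin 2) ℂ) - fundamentalRep (Fin 2) (x e))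
        ((fundamentalRep (Fin 2) (xs n e) : Matrix (Fin 2) (Fin 2) ℂ) - fundamentalRep (Fin 2) (x e))) atTop (𝓝 0) := by
    have hc := continuous_hsDist (L := L) (X := GaugeConfig 3 L (Matrix.specialUnitaryGroup (Fin 2) ℂ))
      (f := fun a => a) (g := fun _ => x) continuous_id' continuous_const
    have h := (hc.tendsto x).comp hxs
    rw [Function.comp_def] at h
    rw [hsDist_self] at h
    exact h
  rw [Metric.tendsto_atTop]
  intro ε hε
  obtain ⟨δ, hδ, hmod⟩ := exists_hsDist_modulus hf (half_pos hε)
  -- Markov: the probability of a `δ`-deviation at time `t`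
  have hP : ∀ n, (P {ω | δ ≤ ∑ e,
      hsForm 2 ((fundamentalRep (Fin 2) (V n t ω e) : Matrix (Fin 2) (Fin 2) ℂ) - fundamentalRep (Fin 2) (U t ω e))
        ((fundamentalRep (Fin 2) (V n t ω e) : Matrix (Fin 2) (Fin 2) ℂ) - fundamentalRep (Fin 2) (U t ω e))}).toReal ≤
      2 * (∑ e, hsForm 2 ((fundamentalRep (Fin 2) (xs n e) : Matrix (Fin 2) (Fin 2) ℂ) - fundamentalRep (Fin 2) (x e))
        ((fundamentalRep (Fin 2) (xs n e) : Matrix (Fin 2) (Fin 2) ℂ) - fundamentalRep (Fin 2) (x e))) *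
        Real.exp (C * t) / δ := by
    intro n
    have hbound := hC hW (xs n) x (hV0 n) hU0 (hV n) hU t le_rfl
    have hle : ∫⁻ ω, ENNReal.ofReal (∑ e,
        hsForm 2 ((fundamentalRep (Fin 2) (V n t ω e) : Matrix (Fin 2) (Fin 2) ℂ) - fundamentalRep (Fin 2) (U t ω e))
          ((fundamentalRep (Fin 2) (V n t ω e) : Matrix (Fin 2) (Fin 2) ℂ) - fundamentalRep (Fin 2) (U t ω e))) ∂P ≤
        2 * ENNReal.ofReal (∑ e,
          hsForm 2 ((fundamentalRep (Fin 2) (xs n e) : Matrix (Fin 2) (Fin 2) ℂ) - fundamentalRep (Fin 2) (x e))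
            ((fundamentalRep (Fin 2) (xs n e) : Matrix (Fin 2) (Fin 2) ℂ) - fundamentalRep (Fin 2) (x e))) *
          ENNReal.ofReal (Real.exp (C * t)) := by
      refine le_trans (lintegral_mono fun ω => ?_) hbound
      exact le_iSup₂_of_le (f := fun s (_ : s ∈ Set.Iic t) => ENNReal.ofReal (∑ e,
        hsForm 2 ((fundamentalRep (Fin 2) (V n s ω e) : Matrix (Fin 2) (Fin 2) ℂ) - fundamentalRep (Fin 2) (U s ω e))
          ((fundamentalRep (Fin 2) (V n s ω e) : Matrix (Fin 2) (Fin 2) ℂ) - fundamentalRep (Fin 2) (U s ω e))))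
        t (Set.mem_Iic.2 le_rfl) le_rfl
    have hset : {ω | δ ≤ ∑ e,
        hsForm 2 ((fundamentalRep (Fin 2) (V n t ω e) : Matrix (Fin 2) (Fin 2) ℂ) - fundamentalRep (Fin 2) (U t ω e))
          ((fundamentalRep (Fin 2) (V n t ω e) : Matrix (Fin 2) (Fin 2) ℂ) - fundamentalRep (Fin 2) (U t ω e))} =
        {ω | ENNReal.ofReal δ ≤ ENNReal.ofReal (∑ e,
          hsForm 2 ((fundamentalRep (Fin 2) (V n t ω e) : Matrix (Fin 2) (Fin 2) ℂ) - fundamentalRep (Fin 2) (U t ω e))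
            ((fundamentalRep (Fin 2) (V n t ω e) : Matrix (Fin 2) (Fin 2) ℂ) - fundamentalRep (Fin 2) (U t ω e)))} := by
      ext ω
      simp only [Set.mem_setOf_eq]
      rw [ENNReal.ofReal_le_ofReal_iff (hsDist_nonneg _ _)]
    have hmk := meas_ge_le_lintegral_div ((hDm n).ennreal_ofReal.aemeasurable)
      ((ENNReal.ofReal_pos.2 hδ).ne') (ENNReal.ofReal_ne_top) (μ := P)
    rw [hset]
    have hfin : 2 * ENNReal.ofReal (∑ e,
          hsForm 2 ((fundamentalRep (Fin 2) (xs n e) : Matrix (Fin 2) (Fin 2) ℂ) - fundamentalRep (Fin 2) (x e))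
            ((fundamentalRep (Fin 2) (xs n e) : Matrix (Fin 2) (Fin 2) ℂ) - fundamentalRep (Fin 2) (x e))) *
          ENNReal.ofReal (Real.exp (C * t)) / ENNReal.ofReal δ ≠ ∞ :=
      ENNReal.div_ne_top (ENNReal.mul_ne_top (ENNReal.mul_ne_top (by norm_num) ENNReal.ofReal_ne_top)
        ENNReal.ofReal_ne_top) ((ENNReal.ofReal_pos.2 hδ).ne')
    have h1 := ENNReal.toReal_mono hfin (hmk.trans (ENNReal.div_le_div_right hle _))
    refine h1.trans (le_of_eq ?_)
    rw [ENNReal.toReal_div, ENNReal.toReal_mul, ENNReal.toReal_mul, ENNReal.toReal_ofReal (hsDist_nonneg _ _),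
      ENNReal.toReal_ofReal (Real.exp_pos _).le, ENNReal.toReal_ofReal hδ.le]
    norm_num
  -- the deviation probabilities tend to zero
  have hPt : Tendsto (fun n => (P {ω | δ ≤ ∑ e,
      hsForm 2 ((fundamentalRep (Fin 2) (V n t ω e) : Matrix (Fin 2) (Fin 2) ℂ) - fundamentalRep (Fin 2) (U t ω e))
        ((fundamentalRep (Fin 2) (V n t ω e) : Matrix (Fin 2) (Fin 2) ℂ) - fundamentalRep (Fin 2) (U t ω e))}).toReal)
      atTop (𝓝 0) := by
    have hlim : Tendsto (fun n => 2 * (∑ e,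
        hsForm 2 ((fundamentalRep (Fin 2) (xs n e) : Matrix (Fin 2) (Fin 2) ℂ) - fundamentalRep (Fin 2) (x e))
          ((fundamentalRep (Fin 2) (xs n e) : Matrix (Fin 2) (Fin 2) ℂ) - fundamentalRep (Fin 2) (x e))) *
        Real.exp (C * t) / δ) atTop (𝓝 0) := by
      have h := ((hD0.const_mul 2).mul_const (Real.exp (C * t))).div_const δ
      simpa using h
    exact squeeze_zero (fun n => ENNReal.toReal_nonneg) hP hlim
  obtain ⟨N, hN⟩ := (Metric.tendsto_atTop.1 hPt) (ε / (4 * M + 4)) (by positivity)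
  refine ⟨N, fun n hn => ?_⟩
  have hPn := hN n hn
  rw [Real.dist_eq, sub_zero, abs_of_nonneg ENNReal.toReal_nonneg] at hPn
  -- pointwise split of `|f(Vⁿ_t) − f(U_t)|`
  set A : Set Ω := {ω | δ ≤ ∑ e,
      hsForm 2 ((fundamentalRep (Fin 2) (V n t ω e) : Matrix (Fin 2) (Fin 2) ℂ) - fundamentalRep (Fin 2) (U t ω e))
        ((fundamentalRep (Fin 2) (V n t ω e) : Matrix (Fin 2) (Fin 2) ℂ) - fundamentalRep (Fin 2) (U t ω e))} with hA
  have hAm : MeasurableSet A := measurableSet_le measurable_const (hDm n)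
  have hptw : ∀ ω, |f (V n t ω) - f (U t ω)| ≤ ε / 2 + 2 * M * A.indicator (fun _ => (1 : ℝ)) ω := by
    intro ω
    by_cases hω : ω ∈ A
    · rw [Set.indicator_of_mem hω, mul_one]
      have h1 : |f (V n t ω) - f (U t ω)| ≤ |f (V n t ω)| + |f (U t ω)| := abs_sub _ _
      linarith [hM (V n t ω), hM (U t ω), hε.le]
    · rw [Set.indicator_of_notMem hω, mul_zero, add_zero]
      have hlt : ∑ e,
          hsForm 2 ((fundamentalRep (Fin 2) (V n t ω e) : Matrix (Fin 2) (Fin 2) ℂ) - fundamentalRep (Fin 2) (U t ω e))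
            ((fundamentalRep (Fin 2) (V n t ω e) : Matrix (Fin 2) (Fin 2) ℂ) - fundamentalRep (Fin 2) (U t ω e)) < δ :=
        not_le.1 hω
      exact (hmod _ _ hlt).le
  have hiV : Integrable (fun ω => f (V n t ω)) P :=
    (integrable_const M).mono' (hfV n).aestronglyMeasurable (Eventually.of_forall fun ω => by
      simpa [Real.norm_eq_abs] using hM (V n t ω))
  have hiU : Integrable (fun ω => f (U t ω)) P :=
    (integrable_const M).mono' hfU.aestronglyMeasurable (Eventually.of_forall fun ω => by
      simpa [Real.norm_eq_abs] using hM (U t ω))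
  have hiInd : Integrable (fun ω => ε / 2 + 2 * M * A.indicator (fun _ => (1 : ℝ)) ω) P :=
    (integrable_const _).add (((integrable_const (1 : ℝ)).indicator hAm).const_mul _)
  rw [Real.dist_eq, ← integral_sub hiV hiU]
  calc |∫ ω, (f (V n t ω) - f (U t ω)) ∂P| ≤ ∫ ω, |f (V n t ω) - f (U t ω)| ∂P := abs_integral_le_integral_abs
    _ ≤ ∫ ω, (ε / 2 + 2 * M * A.indicator (fun _ => (1 : ℝ)) ω) ∂P :=
        integral_mono (hiV.sub hiU).abs hiInd hptw
    _ = ε / 2 + 2 * M * (P A).toReal := by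
        rw [integral_add (integrable_const _) (((integrable_const (1 : ℝ)).indicator hAm).const_mul _),
          integral_const, probReal_univ, one_smul, integral_const_mul, integral_indicator hAm, setIntegral_const,
          smul_eq_mul, mul_one, measureReal_def]
    _ < ε := by
        have h4 : 2 * M * (P A).toReal ≤ 2 * M * (ε / (4 * M + 4)) := mul_le_mul_of_nonneg_left hPn.le (by positivity)
        have h5 : 2 * M * (ε / (4 * M + 4)) < ε / 2 := by
          rw [mul_div_assoc']
          rw [div_lt_div_iff₀ (by positivity) (by positivity)]
          nlinarith
        linarith

/-- **The Feller property of the SU(2) lattice Langevin dynamics**: for every Markov kernel family `κ` realising the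
transition laws of the Shen–Zhu–Zhu dynamics at coupling `β'` (e.g. `exists_transitionKernel`), every lattice time
`t` and every continuous `f`, the function `x ↦ ∫ f d(κ t x) = E f(U^x_t)` is continuous on `SU(2)^E`.
[cite: ShenZhuZhu2022, §3 (Markov semigroup P_t^L after Lemma 3.3, p. 13)] -/
theorem continuous_integral_transitionKernel (L : ℕ) [NeZero L] (β' : ℝ)
    (κ : ℝ≥0 → Kernel (GaugeConfig 3 L (Matrix.specialUnitaryGroup (Fin 2) ℂ))
      (GaugeConfig 3 L (Matrix.specialUnitaryGroup (Fin 2) ℂ)))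
    (hreal : ∀ (t : ℝ≥0) (x : GaugeConfig 3 L (Matrix.specialUnitaryGroup (Fin 2) ℂ))
        (Ω : Type) [MeasurableSpace Ω] (P : Measure Ω) [IsProbabilityMeasure P]
        (W : ℝ≥0 → Ω → (Edge 3 L × NoiseIdx 2 → ℝ)) (hW : IsFlatBrownian W P)
        (U : ℝ≥0 → Ω → GaugeConfig 3 L (Matrix.specialUnitaryGroup (Fin 2) ℂ)),
        (∀ ω, U 0 ω = x) →
        (latticeLangevinDynamics (fundamentalLatticeRep 2) β').IsSolution (fundamentalRep (Fin 2))
          hW.natFiltration P W U →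
        κ t x = P.map (U t))
    (t : ℝ≥0) {f : GaugeConfig 3 L (Matrix.specialUnitaryGroup (Fin 2) ℂ) → ℝ} (hf : Continuous f) :
    Continuous fun x => ∫ y, f y ∂(κ t x) := by
  haveI := secondCountableTopology_su2
  haveI := borelSpace_config L
  haveI := isProbabilityMeasure_piWiener (Edge 3 L × NoiseIdx 2)
  have hWc := isFlatBrownian_piWiener 3 L (NoiseIdx 2)
  -- solutions from every start on the product Wiener space; the kernel integrals are their expectations
  choose Ux hUx0 hUx using fun x : GaugeConfig 3 L (Matrix.specialUnitaryGroup (Fin 2) ℂ) =>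
    solution_from_start hWc β' x
  have hrepr : ∀ x, ∫ y, f y ∂(κ t x) =
      ∫ ω, f (Ux x t ω) ∂(Measure.pi fun _ : Edge 3 L × NoiseIdx 2 => preWienerMeasure) := by
    intro x
    have hm : Measurable (Ux x t) := ((hUx x).adapted t).mono (hWc.natFiltration.le t) le_rfl
    rw [hreal t x _ (Measure.pi fun _ : Edge 3 L × NoiseIdx 2 => preWienerMeasure) _ hWc (Ux x) (hUx0 x) (hUx x),
      integral_map hm.aemeasurable hf.aestronglyMeasurable]
  simp_rw [hrepr]
  refine continuous_iff_seqContinuous.2 fun xs x hxs => ?_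
  exact tendsto_integral_solutions hWc β' hxs (V := fun n => Ux (xs n)) (fun n ω => hUx0 _ ω) (fun n => hUx _)
    (hUx0 x) (hUx x) hf t

end Summit.QuantumFields.YangMills.Theorems.ColdStartUniversality

end
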